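import Literature.Probability.LatticeModels.FKIsingDiamondReduction
import HarnessLib

/-!
# `fkIsing_rsw` holds: the RSW crossing bound for the critical FK-Ising model (DCHN 2011, Thm. 1)

Topic `Literature/Probability/LatticeModels`; the discharge of the named fact
`Literature.Probability.LatticeModels.fkIsing_rsw` of `FKIsingRSW.lean` — Duminil-Copin, Hongler and
Nolin's Theorem 1 (free boundary conditions, aspect ratio `4`; Duminil-Copin–Smirnov 2012,
Theorem 3.16): there is `c > 0` such that for all `n ≥ 1` the critical FK-Ising measure with free
boundary conditions on `[0, 4n] × [0, n]` gives the open left–right crossing probability at least `c`.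

The proof is the published one, assembled across the tree: Smirnov's fermionic observable and its
primitive `H` (sub/superharmonicity, boundary modifications), the second-moment lower bound
(`FKIsingRSWSecondMoment`, `FKIsingRSWTwoPoint`: `fkIsing_rsw_of_halfPlaneArmBounds`), the
half-plane one-arm upper bound `(hA)` (`FKIsingHalfPlaneArm`), and the strong arm bound for balls
`(hB)` = DCHN's Lemma 15 (`FKIsingDiamondReduction.fkIsing_ballArmBound`, from the slit-domain
observable: `FKFamilyObservable`, `FKFamilyPrimitive`, `FKFamilyPassage`, `FKCylinderFamily`,
`FKSlitThreeSided`, `SlitExplorationParity`, `SlitCanonicalBarrier`, `FKSlitLowerBound`).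

## References

* H. Duminil-Copin, C. Hongler, P. Nolin, *Connection probabilities and RSW-type bounds for the
  two-dimensional FK Ising model*, Comm. Pure Appl. Math. 64 (2011) 1165–1198, Theorem 1 — bib key
  `DuminilCopinHonglerNolin2011`.
* H. Duminil-Copin, S. Smirnov, *Conformal invariance of lattice models*, in: Probability and
  Statistical Physics in Two and More Dimensions, Clay Math. Proc. 15 (2012), Theorem 3.16
  (arXiv:1109.1549) — bib key `DuminilCopinSmirnov2012Clay`.
-/

namespace Literature.Probability.LatticeModels

/-- **Theorem 1 of Duminil-Copin–Hongler–Nolin (RSW for the critical FK-Ising model, free boundary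
conditions): the named fact `fkIsing_rsw` holds.** [cite: DuminilCopinHonglerNolin2011, Theorem 1;
DuminilCopinSmirnov2012Clay, Theorem 3.16] -/
theorem fkIsing_rsw_holds : fkIsing_rsw :=
  fkIsing_rsw_of_ballArmBound LatticeDobrushin.fkIsing_ballArmBound

end Literature.Probability.LatticeModels
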